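import Summits.QuantumFields.YangMills.Theorems.UnitScaleTiltProp7DivRecoveryAssemblyBudget
import Summits.QuantumFields.YangMills.Theorems.UnitScaleTiltProp7DivRecoveryForm
import Summits.QuantumFields.YangMills.Theorems.UnitScaleTiltProp7SectET3CombLettersT3
import HarnessLib

/-!
# Prop. 7 on T³ — lane II (B7-ROWS⟹COLL): the collected row `hColl` from the per-member patch rows

Route `UnitScaleTilt`, crux `MinimiserStabilityRegPr` (stmt-QuantumFields-19200), E′ growth side, lane II «divergence recovery at the curved regular member».
The quantifier plumbing between the member files and ✓`Prop7DivRecoveryOfCollected.hRec_of_collected`: its hypothesis `hColl` (constants `A₃` BEFORE the patch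
exponent `s`, `A₁ A₂ A₄ eC` after) from ONE displayed schema `hRows` = «at every member with `s < F.m + n` and every one-form `y` there are patch-indexed reals obeying
the input rows of ✓`Prop7DivRecoveryAssemblyBudget.summed_budget` together with the (B7-MEMBER-CORE) row», the `s`-FREE coefficients (`ν a₂ a₃ cL cMR cHM`, hence `A₃`)
being chosen before `s`.  Pure real bookkeeping over `summed_budget`; the AVG currency is converted by `a₀ > 0`.

HONEST SCOPE.  Bookkeeping; `hRows` is OPEN (the member geometry file discharges it from the bricks); nothing of (REC)∕hN06∕hcoS∕E′∕EX∕the crux is proved here; YM₃ on T³ is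
rung R3 — NOT d = 4, NOT infinite volume, NOT a mass gap, NOT Clay.
[cite: Balaban1985BackgroundPropagators, (3.10) p.392, (3.20)-(3.26) pp.394-395]
-/

noncomputable section

open scoped InnerProductSpace ComplexConjugate BigOperators Matrix.Norms.L2Operator

namespace Summit.QuantumFields.YangMills.Theorems.Prop7DivRecoveryCollectedOfRows

open Literature.MathematicalPhysics.QuantumFieldTheory.Balaban1983to89
open Literature.MathematicalPhysics.QuantumFieldTheory.Balaban1983to89.T3ContinuumYM3Torus
open T3PrintedRegularMinimiser (RegPr)
open B11Eq103H1Complex (SiteL2K BondL2K)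
open Summit.QuantumFields.YangMills.Theorems.Prop7SectET3Transport (periodsT3)
open Summit.QuantumFields.YangMills.Theorems.Prop7SectET3HilbertLetters (W₂ DL2 DstarL2)
open Summit.QuantumFields.YangMills.Theorems.Prop7SectET3WilsonHessian (DeltaEtaSlot)
open Summit.QuantumFields.YangMills.Theorems.Prop7SectET3CombLetters (Qkc)
open Summit.QuantumFields.YangMills.Theorems.Prop7QprimeCombL2 (RcombL2)
open Summit.QuantumFields.YangMills.Theorems.Prop7DivRecoveryAssemblyBudget (summed_budget)

variable (c₀ cB a₀ : ℕ → ℝ) [hc₀ : ∀ L : ℕ, Fact (0 < c₀ L)] [hcB : ∀ L : ℕ, Fact (0 < cB L)]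

/-- ★★★ **(B7-ROWS⟹COLL).**  `hRows`: for every `L > 1` the `s`-free data `ν a₂ a₃ cL cMR cHM ≥ 0`, then for every patch exponent `s` the remaining nonnegative
coefficients and a radius `0 < eC ≤ 1`, such that at every member with `s < F.m + n`, `0 < e ≤ eC`, `RegPr`, and every `y`, there are patch-indexed reals (index
`Site (F.P K) 0`, the cutoff centres of ✓`exists_cutoffPackage`) `N Cu As ρ Φ K L M Hρ HM` and seven global reals `Sr SM SHr SHM SL SK SΦ` with: the seven per-patch
bounds (input shapes of ✓`summed_budget`, `R := L^s`), the three overlap sums against `‖y‖²`, `re⟪y,Δ^η y⟫ + 1029e‖y‖²`, `(c₀∕cB)ℓ³‖Qkc y‖²`, the five family-sum rows, and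
the (B7-MEMBER-CORE) row for `G := ‖D*y − R(D*y)‖²`.  Conclusion: `hColl` of ✓`hRec_of_collected` VERBATIM (`A₃ := a₂ν²cMR + a₃ν²cHM + 3ν²cL`).
[cite: Balaban1985BackgroundPropagators, (3.10) p.392, (3.20)-(3.26) pp.394-395] -/
theorem hColl_of_rows (ha₀ : ∀ L, 1 < L → 0 < a₀ L)
    (hRows : ∀ (L : ℕ), 1 < L → ∃ ν a₂ a₃ cL cMR cHM : ℝ, 0 ≤ ν ∧ 0 ≤ a₂ ∧ 0 ≤ a₃ ∧ 0 ≤ cL ∧ 0 ≤ cMR ∧ 0 ≤ cHM ∧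
      ∀ s : ℕ, ∃ a₁ a₄ cΦ cρCu cρN cKCu cKN cMAs cMCu cMe cHCu cHN eC : ℝ,
        0 ≤ a₁ ∧ 0 ≤ a₄ ∧ 0 ≤ cΦ ∧ 0 ≤ cρCu ∧ 0 ≤ cρN ∧ 0 ≤ cKCu ∧ 0 ≤ cKN ∧ 0 ≤ cMAs ∧ 0 ≤ cMCu ∧ 0 ≤ cMe ∧ 0 ≤ cHCu ∧ 0 ≤ cHN ∧
        0 < eC ∧ eC ≤ 1 ∧
        ∀ (F : T3Family), F.L = L → ∀ (n K : ℕ) (hnK : n < K) (e : ℝ) (W : GaugeField (F.P K) 0 (Matrix.specialUnitaryGroup (Fin 2) ℂ)),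
          s < F.m + n → 0 < e → e ≤ eC → RegPr F n K e W →
          ∀ y : BondL2K ℂ 3 (periodsT3 F K) (c₀ F.L) W₂,
            ∃ (Ni Cui Asi ρi Φi Ki Li Mi Hρi HMi : Site (F.P K) 0 → ℝ) (Sr SM SHr SHM SL SK SΦ : ℝ),
              (∀ i, Φi i ≤ cΦ * ((F.L : ℝ) ^ s) ^ 2 * Ni i) ∧
              (∀ i, ρi i ≤ cρCu * Cui i + cρN * e * Ni i) ∧
              (∀ i, Ki i ≤ cKCu * Cui i + cKN * e * Ni i) ∧
              (∀ i, Li i ≤ cL * ((F.L : ℝ) ^ s)⁻¹ ^ 2 * Ni i) ∧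
              (∀ i, Mi i ≤ cMAs * Asi i + cMCu * Cui i + (cMR * ((F.L : ℝ) ^ s)⁻¹ ^ 2 + cMe * e) * Ni i) ∧
              (∀ i, Hρi i ≤ cHCu * Cui i + cHN * e * Ni i) ∧
              (∀ i, HMi i ≤ cHM * ((F.L : ℝ) ^ s)⁻¹ ^ 2 * Ni i) ∧
              (∑ i, Ni i ≤ ν * ‖y‖ ^ 2) ∧
              (∑ i, Cui i ≤ ν * (RCLike.re ⟪y, DeltaEtaSlot F n K (c₀ F.L) W y⟫_ℂ + 1029 * e * ‖y‖ ^ 2)) ∧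
              (∑ i, Asi i ≤ ν * ((c₀ F.L / cB F.L) * ((F.L : ℝ) ^ (K - n)) ^ 3 * ‖Qkc F n K hnK.le (c₀ F.L) (cB F.L) W y‖ ^ 2)) ∧
              (Sr ≤ ν * ∑ i, ρi i) ∧ (SM ≤ ν * ∑ i, Mi i) ∧ (SHr ≤ ν * ∑ i, Hρi i) ∧ (SHM ≤ ν * ∑ i, HMi i) ∧
              (SL ≤ ν * ∑ i, Li i) ∧ (SK ≤ ν * ∑ i, Ki i) ∧ (0 ≤ SΦ) ∧ (SΦ ≤ ν * ∑ i, Φi i) ∧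
              ‖DstarL2 F n K (c₀ F.L) W y - RcombL2 F n K (c₀ F.L) W (DstarL2 F n K (c₀ F.L) W y)‖ ^ 2
                ≤ a₁ * ((c₀ F.L / cB F.L) * ((F.L : ℝ) ^ (K - n)) ^ 3 * ‖Qkc F n K hnK.le (c₀ F.L) (cB F.L) W y‖ ^ 2)
                  + a₂ * (Sr + SM) + a₃ * (SHr + SHM) + a₄ * e ^ 2 * SΦ + 3 * SL + 3 * SK) :
    ∀ (L : ℕ), 1 < L → ∃ A₃ : ℝ, 0 ≤ A₃ ∧ ∀ s : ℕ, ∃ A₁ A₂ A₄ eC : ℝ, 0 ≤ A₁ ∧ 0 ≤ A₂ ∧ 0 ≤ A₄ ∧ 0 < eC ∧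
      ∀ (F : T3Family), F.L = L → ∀ (n K : ℕ) (hnK : n < K) (e : ℝ) (W : GaugeField (F.P K) 0 (Matrix.specialUnitaryGroup (Fin 2) ℂ)),
        s < F.m + n → 0 < e → e ≤ eC → RegPr F n K e W →
        ∀ y : BondL2K ℂ 3 (periodsT3 F K) (c₀ F.L) W₂,
          ‖DstarL2 F n K (c₀ F.L) W y - RcombL2 F n K (c₀ F.L) W (DstarL2 F n K (c₀ F.L) W y)‖ ^ 2
            ≤ A₁ * ((a₀ F.L * (c₀ F.L / cB F.L) * ((F.L : ℝ) ^ (K - n)) ^ 3) * ‖Qkc F n K hnK.le (c₀ F.L) (cB F.L) W y‖ ^ 2)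
              + A₂ * (RCLike.re ⟪y, DeltaEtaSlot F n K (c₀ F.L) W y⟫_ℂ + 1029 * e * ‖y‖ ^ 2)
              + (A₃ * ((F.L : ℝ) ^ s)⁻¹ ^ 2 + A₄ * e) * ‖y‖ ^ 2 := by
  intro L hL
  obtain ⟨ν, a₂, a₃, cL, cMR, cHM, hν, ha₂, ha₃, hcL, hcMR, hcHM, hs⟩ := hRows L hL
  have ha : 0 < a₀ L := ha₀ L hL
  refine ⟨a₂ * ν ^ 2 * cMR + a₃ * ν ^ 2 * cHM + 3 * ν ^ 2 * cL, by positivity, fun s => ?_⟩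
  obtain ⟨a₁, a₄, cΦ, cρCu, cρN, cKCu, cKN, cMAs, cMCu, cMe, cHCu, cHN, eC,
    ha₁, ha₄, hcΦ, hcρCu, hcρN, hcKCu, hcKN, hcMAs, hcMCu, hcMe, hcHCu, hcHN, heC, heC1, hmem⟩ := hs s
  refine ⟨(a₁ + a₂ * ν ^ 2 * cMAs) / a₀ L,
    a₂ * ν ^ 2 * (cρCu + cMCu) + a₃ * ν ^ 2 * cHCu + 3 * ν ^ 2 * cKCu,
    a₂ * ν ^ 2 * (cρN + cMe) + a₃ * ν ^ 2 * cHN + a₄ * ν ^ 2 * cΦ * ((L : ℝ) ^ s) ^ 2 + 3 * ν ^ 2 * cKN,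
    eC, by positivity, by positivity, by positivity, heC, ?_⟩
  intro F hF n K hnK e W hsm he heC' hreg y
  obtain ⟨Ni, Cui, Asi, ρi, Φi, Ki, Li, Mi, Hρi, HMi, Sr, SM, SHr, SHM, SL, SK, SΦ,
    hΦ, hρ, hK, hLi, hM, hHρ, hHM, hsumN, hsumCu, hsumAs, hSr, hSM, hSHr, hSHM, hSL, hSK, hSΦ0, hSΦ, hcore⟩ :=
    hmem F hF n K hnK e W hsm he heC' hreg y
  subst hF
  have he1 : e ≤ 1 := heC'.trans heC1
  -- the budget
  have h := summed_budget (ι := Site (F.P K) 0) (N := ‖y‖ ^ 2)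
    (Cplus := RCLike.re ⟪y, DeltaEtaSlot F n K (c₀ F.L) W y⟫_ℂ + 1029 * e * ‖y‖ ^ 2)
    (AVG := (c₀ F.L / cB F.L) * ((F.L : ℝ) ^ (K - n)) ^ 3 * ‖Qkc F n K hnK.le (c₀ F.L) (cB F.L) W y‖ ^ 2)
    (G := ‖DstarL2 F n K (c₀ F.L) W y - RcombL2 F n K (c₀ F.L) W (DstarL2 F n K (c₀ F.L) W y)‖ ^ 2)
    (R := (F.L : ℝ) ^ s) (a₁ := a₁)
    Ni Cui Asi ρi Φi Ki Li Mi Hρi HMi he.le he1 hν ha₂ ha₃ ha₄ hcΦ hcρCu hcρN hcKCu hcKN hcL hcMAs hcMCu hcMR hcMe hcHCu hcHN hcHM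
    hΦ hρ hK hLi hM hHρ hHM hsumN hsumCu hsumAs hSr hSM hSHr hSHM hSL hSK hSΦ0 hSΦ hcore
  -- the AVG currency: `X·AVGres = (X∕a₀)·(a₀·AVGres)`
  have hAVG : (a₁ + a₂ * ν ^ 2 * cMAs) * ((c₀ F.L / cB F.L) * ((F.L : ℝ) ^ (K - n)) ^ 3 * ‖Qkc F n K hnK.le (c₀ F.L) (cB F.L) W y‖ ^ 2)
      = (a₁ + a₂ * ν ^ 2 * cMAs) / a₀ F.L
          * ((a₀ F.L * (c₀ F.L / cB F.L) * ((F.L : ℝ) ^ (K - n)) ^ 3) * ‖Qkc F n K hnK.le (c₀ F.L) (cB F.L) W y‖ ^ 2) := by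
    field_simp
  rw [hAVG] at h
  have hid : (a₂ * ν ^ 2 * cMR + a₃ * ν ^ 2 * cHM + 3 * ν ^ 2 * cL) * ((F.L : ℝ) ^ s)⁻¹ ^ 2
      + (a₂ * ν ^ 2 * (cρN + cMe) + a₃ * ν ^ 2 * cHN + a₄ * ν ^ 2 * cΦ * ((F.L : ℝ) ^ s) ^ 2 + 3 * ν ^ 2 * cKN) * e
      = (a₂ * ν ^ 2 * cMR + a₃ * ν ^ 2 * cHM + 3 * ν ^ 2 * cL) * ((F.L : ℝ) ^ s)⁻¹ ^ 2
      + (a₂ * ν ^ 2 * (cρN + cMe) + a₃ * ν ^ 2 * cHN + a₄ * ν ^ 2 * cΦ * ((F.L : ℝ) ^ s) ^ 2 + 3 * ν ^ 2 * cKN) * e := rfl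
  linarith

end Summit.QuantumFields.YangMills.Theorems.Prop7DivRecoveryCollectedOfRows

end
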